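import Summits.ResolutionOfSingularities.ResolutionOfSingularities.Theorems.HilbertSamuelEliminationSigmaMaxModificationsCorridor3SigmaLocalChains
import Summits.ResolutionOfSingularities.ResolutionOfSingularities.Theorems.HilbertSamuelEliminationSigmaMaxModificationsCorridor3SigmaHybridScope
import Summits.ResolutionOfSingularities.ResolutionOfSingularities.Theorems.HilbertSamuelEliminationSigmaMaxModificationsCorridor3SigmaCyclePlusBoundaryPackage
import Summits.ResolutionOfSingularities.ResolutionOfSingularities.Theorems.HilbertSamuelEliminationSigmaMaxModificationsCorridor3SigmaIsoBoundaryReaches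
import HarnessLib

/-!
# [OURS · L1 W4.2] σ-LAYER — Ω-TRANSPORT brick 4′/4E: the transfer row (T) in STRATEGY-FREE form (blow-up data over good stages) and
# along the chains of ANY functional boundary-reading strategy `σ : StrategyE` with permissible in-stratum centres (Ω⁺E, the menu hybrids)

Crux chain w42 (`SigmaMaxModifications`, stmt-ResolutionOfSingularities-18506; conjunct `SigmaMaxModificationsCorridor3`,
stmt-ResolutionOfSingularities-19249), res-L1-w42-plan-1 RULING v3.14-12 (BR-6) / v3.14-14 (DL) «Ω-transports of the W-low rows — 040»;
object (a) of res-type-040's 12:30Z line. Typer res-type-040 (gen 19). Sequel of brick 4 (`…Corridor3SigmaLocalChains`: §1 strategy-free chain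
lemmas, §2 `CycleInvPlus.cycleInv_forget`, §3 `Sigma.movingLineageLocalizes_Ωplus`). OURS (cell res-hironaka, slot W4.2); NOT statements of
H. Hironaka's manuscript [Hironaka2017] nor of [CossartJannsenSaito2020]; AI-drafted, weaker than expert review. Sorry-free PROOF file: no new
definition, no named fact, no binder. Helper file `--supports stmt-ResolutionOfSingularities-19249` (counted 0).

THE POINT. Of stub-4's strata kernels, (c-geo) «no lineage through the chain points lies in the centres infinitely often» is the one whose
proof ((T) transfer ∧ (K) kill, card H) never reads labels, cycles or the oracle: it needs only (i) GOOD stages (finite type over a field,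
reduced, `dim ≤ N`, `ν` never exceeded — res-D-pv-047's `RunGood`, p529895), (ii) the steps ARE blow-ups `f n : X_{n+1} ⟶ X_n` in centres `C n`,
(iii) at the stages where the lineage is hit the centre is REGULAR and INSIDE `X_n(ν)`, (iv) the marked points lie in the stratum and are never
isolated (closedness is not needed). §2 proves (T) in exactly this form (`Sigma.movingLineageLocalizes_of_blowupData`); §3 reads it for the chains of an ARBITRARY functional
boundary-reading strategy `σ : StrategyE` whose steps at the chain's states have PERMISSIBLE centres inside the stratum
(`Sigma.movingLineageLocalizes_σE` — functionality only identifies a hit centre with the presented one; permissible ⇒ regular by CJS Def. 3.1 (2)),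
hence for res-L1-type-o1's menu-disciplined HYBRIDS `π.hybrid τ` on good scopes (their steps are admissible: `isAdmissibleStrategyOnE_hybrid_plus`)
as much as for Ω⁺E; §4 spells out the Ω⁺E instance from a maximal origin (`Sigma.movingLineageLocalizes_ΩplusE`, via res-D-brk-3's
`exists_cycleInvPlus_chainE` / `CycleInvPlus.centreE`). With the strategy-free kill row `Moving.LocalNearPointChainsTerminate` (res-D-pv-046,
modulo `LocalChainPrintedFacts`) each instance forbids moving lineages at levels `0 < N ≤ 3` (`Sigma.no_movingLineage_σE_of_localChains`).
No σE strata ROW is typed here ((BR-4): the σE kernel rows await plan-1's word); the conclusions are stated on the unbundled lineage data.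

References: CJS LNM 2270 Lemma 6.30 (proof via `X_η`, p. 97), Prop. 6.31, Def. 3.1 (2), Rem. 6.29 (1), Def. 6.38/6.39, p. 107
[CossartJannsenSaito2020]; Stacks Tags 00GU, 02OS [StacksProject]; tree `…SigmaLocalChains` (brick 4), `…SigmaHybridScope` (p529895),
`…SigmaCyclePlusBoundaryPackage` (res-D-brk-3), `…SigmaIsoBoundaryDefs`/`…Reaches` (res-type-012, `StepProjectionσE`, `pt_mem_hsStratum_of_reachesσE`), `…SigmaBoundaryDefs` (p523041),
`…WLadderLocalChainsLocalize` (p513904, res-type-053), `…WLadderLocalChainsTerminate` (res-D-pv-046).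
-/

noncomputable section

set_option linter.dupNamespace false

open CategoryTheory CategoryTheory.Limits AlgebraicGeometry TopologicalSpace Topology IsLocalRing Order
open Summit.ResolutionOfSingularities.ResolutionOfSingularities.Theorems.CampaignW42
open Literature.AlgebraicGeometry.Resolution Literature.RingTheory.HilbertSamuel
open Literature.AlgebraicGeometry.CossartJannsenSaito2020
open Summit.ResolutionOfSingularities.ResolutionOfSingularities.Theorems.SigmaMaxModificationsCorridor3
open Summit.ResolutionOfSingularities.ResolutionOfSingularities.Theorems.SigmaMaxModificationsCorridor3.Moving
open Scheme.IdealSheafData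

namespace Summit.ResolutionOfSingularities.ResolutionOfSingularities.Theorems.SigmaMaxModificationsCorridor3.Sigma

universe u

/-! ## §1. Permissible centres are regular closed subschemes -/

/-- **A PERMISSIBLE centre is a REGULAR closed subscheme** (CJS Def. 3.1 (2), first clause, read through `𝒪_{V(C),z} ≅ 𝒪_{X,z}/C_z`).
[cite: CossartJannsenSaito2020, Def. 3.1 (2)] -/
theorem isRegular_subscheme_of_isPermissible {W : Scheme.{u}} {C : W.IdealSheafData} (hC : IdealSheafData.IsPermissible C) :
    Literature.AlgebraicGeometry.Resolution.Scheme.IsRegular C.subscheme := by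
  intro z
  have hz : C.subschemeι.base z ∈ (C.support : Set W) := by
    rw [← Scheme.IdealSheafData.range_subschemeι C]
    exact ⟨z, rfl⟩
  exact (isRegularLocalRing_stalk_subscheme_iff C z).mpr (hC _ hz).isRegularLocalRing

/-! ## §2. The transfer row (T), strategy-free: blow-up data over good stages -/

section BlowupData

variable {N : ℕ} {ν : ℕ → ℕ} {k : Type u} [Field k] {c : ℕ → MarkedStage.{u}}

/-- **THE TRANSFER ROW (T) IN STRATEGY-FREE, MARKED-POINT-FREE FORM — PROVED.** Stages `X_n = (c n).W` GOOD over `k` (`RunGood`: finite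
type, reduced, `dim ≤ N`, `ν` never exceeded; the marked points of `c` are NOT used); blow-up data `f n : X_{n+1} ⟶ X_n`, `IsBlowup (f n) (C n)`;
a lineage of POSITIVE-DIMENSIONAL (`Set.Nontrivial`) irreducible components `Z n` of the strata `X_n(ν)`, `Z (n+1)` dominating `Z n` under `f n`,
hit (`Z m ⊆ V(C m)`) at infinitely many stages, the centre being REGULAR and INSIDE `X_m(ν)` whenever it is hit. Then the lineage localises at its
generic points to an infinite chain of LOCAL near-point steps `(S_i, s_i)`, `S_0` excellent, reduced, of dimension `≤ N − 1`, every `s_i` isolated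
in the Hilbert–Samuel locus of `S_i` (res-type-053's construction of `movingLineageLocalizesM_holds`; no oracle, no labels, no cycles, no chain
of closed points — the form a NON-CLOSED point `ξ ∈ X_n(ν)` whose closure is a stratum component needs, cf. plan-1's (SD2)).
[cite: CossartJannsenSaito2020, Lemma 6.30, Prop. 6.31, p. 107] -/
theorem movingLineageLocalizes_of_blowupData (hgood : ∀ n, RunGood k N ν (c n).W)
    {f : ∀ n, (c (n + 1)).W ⟶ (c n).W} {C : ∀ n, (c n).W.IdealSheafData} (hb : ∀ n, IsBlowup (f n) (C n))
    {Z : ∀ n, Set (c n).W} (hZ : ∀ n, Z n ∈ componentsIn (Scheme.hsStratum (c n).W N ν))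
    (hZnt : ∀ n, (Z n).Nontrivial) (hdom : ∀ n, closure ((f n).base '' Z (n + 1)) = Z n)
    (hcen : ∀ n, Z n ⊆ ((C n).support : Set (c n).W) →
      Literature.AlgebraicGeometry.Resolution.Scheme.IsRegular (C n).subscheme ∧
        ((C n).support : Set (c n).W) ⊆ Scheme.hsStratum (c n).W N ν)
    (hhit : ∀ n, ∃ m, n ≤ m ∧ Z m ⊆ ((C m).support : Set (c m).W)) :
    ∃ (S : ℕ → Scheme.{u}) (ln : ∀ i, IsLocallyNoetherian (S i)) (pt : ∀ i, S i),
      Scheme.IsExcellent (S 0) ∧ IsReduced (S 0) ∧ topologicalKrullDim ↥(S 0) ≤ ((N - 1 : ℕ) : WithBot ℕ∞) ∧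
      IsLocalNearPointChain N S pt ∧ ∀ i, @IsIsolatedInHSMaxLocus (S i) (ln i) N (pt i) := by
  -- 1. stub-4's cycle invariant on the stages with their cycle state and labels forgotten (oracle-free fields only)
  have hinv : ∀ n, Moving.CycleInv k (fun _ _ => True) N ν ⟨(c n).W, (c n).ln, Labelling.init (c n).W, none, (c n).pt⟩ := fun n =>
    { overField := (hgood n).overField
      isReduced := (hgood n).isReduced
      dim_le := (hgood n).dim_le
      supMax := (hgood n).supMax
      label_le_year := fun _ => le_rfl
      pending := fun _ h => by cases h }
  have hZcl : ∀ n, IsClosed (Z n) := fun n => componentsIn.isClosed (hgood n).isClosed_hsStratum (hZ n)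
  have hZirr : ∀ n, IsIrreducible (Z n) := fun n => componentsIn.isIrreducible (hZ n)
  -- 2. generic points, and a second point of each `Z n`
  let η : ∀ n, (c n).W := fun n => (hZirr n).genericPoint
  have hη : ∀ n, IsGenericPoint (η n) (Z n) := fun n => by
    have h := (hZirr n).isGenericPoint_genericPoint_closure
    rwa [(hZcl n).closure_eq] at h
  have hover : ∀ n, (f n).base (η (n + 1)) = η n := base_genericPoint_of_dom hη hdom
  have hην : ∀ n, η n ∈ Scheme.hsStratum (c n).W N ν := fun n => componentsIn.subset (hZ n) (hη n).mem
  have hsnd : ∀ n, ∃ y ∈ Z n, y ≠ η n := fun n => by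
    obtain ⟨a, ha, b, hb, hab⟩ := hZnt n
    by_cases h : a = η n
    · exact ⟨b, hb, fun hb' => hab (h.trans hb'.symm)⟩
    · exact ⟨a, ha, h⟩
  have hhit' : ∀ n, ∃ m, n ≤ m ∧ η m ∈ ((C m).support : Set (c m).W) := fun n => by
    obtain ⟨m, hnm, hZC⟩ := hhit n
    exact ⟨m, hnm, hZC (hη m).mem⟩
  -- the tail on which fibres are «closed»
  obtain ⟨n₀, huniq⟩ := exists_forall_eq_genericPoint_of_specializes_of_isBlowup hb (fun n => (hgood n).dim_le) hη hdom
  -- 3. the hits after `n₀`, enumerated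
  let P : ℕ → Prop := fun m => n₀ ≤ m ∧ η m ∈ ((C m).support : Set (c m).W)
  have hPinf : (setOf P).Infinite := by
    refine Set.infinite_of_forall_exists_gt fun n => ?_
    obtain ⟨m, hnm, hm⟩ := hhit' (max n₀ n + 1)
    exact ⟨m, ⟨le_trans (le_max_left _ _) (Nat.le_of_succ_le hnm), hm⟩, lt_of_lt_of_le (Nat.lt_succ_of_le (le_max_right _ _)) hnm⟩
  let mH : ℕ → ℕ := Nat.nth P
  have hmH : ∀ i, P (mH i) := Nat.nth_mem_of_infinite hPinf
  have hmHmono : StrictMono mH := Nat.nth_strictMono hPinf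
  have hmiss : ∀ i j, j < mH (i + 1) - (mH i + 1) →
      η (mH i + 1 + j) ∉ ((C (mH i + 1 + j)).support : Set (c (mH i + 1 + j)).W) := by
    intro i j hj hmem
    have hlt : mH i + 1 + j < mH (i + 1) := by omega
    have hPm : P (mH i + 1 + j) := ⟨le_trans (hmH i).1 (by omega), hmem⟩
    have := Nat.le_nth_of_lt_nth_succ hlt hPm
    change mH i + 1 + j ≤ mH i at this
    omega
  -- the centre at a hit: radical with maximal stalk ideal at the generic point
  have hZC : ∀ i, Z (mH i) ⊆ ((C (mH i)).support : Set (c (mH i)).W) := fun i =>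
    ((hη (mH i)).mem_closed_set_iff (C (mH i)).support.isClosed).mp (hmH i).2
  have hrad : ∀ i, C (mH i) = vanishingIdeal (C (mH i)).support := fun i =>
    Helpers.eq_vanishingIdeal_support_of_isRegular_subscheme _ (hcen (mH i) (hZC i)).1
  -- 4. the local schemes
  let S : ℕ → Scheme.{u} := fun i => Spec ((c (mH i)).W.presheaf.stalk (η (mH i)))
  have ln : ∀ i, IsLocallyNoetherian (S i) := fun i => by
    haveI := (c (mH i)).ln
    show IsLocallyNoetherian (Spec _)
    infer_instance
  let pt : ∀ i, S i := fun i => closedPoint ((c (mH i)).W.presheaf.stalk (η (mH i)))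
  refine ⟨S, ln, pt, (hinv (mH 0)).isExcellent_Spec_stalk _, (hinv (mH 0)).isReduced_Spec_stalk _, ?_, ?_, ?_⟩
  · -- dimension `≤ N - 1`
    have hN : N ≤ N - 1 + 1 := by omega
    have hdim' : topologicalKrullDim (c (mH 0)).W ≤ ((N - 1 + 1 : ℕ) : WithBot ℕ∞) :=
      (hgood (mH 0)).dim_le.trans (by exact_mod_cast hN)
    obtain ⟨y, hy, hne⟩ := hsnd (mH 0)
    exact topologicalKrullDim_Spec_stalk_le_of_isGenericPoint (hη (mH 0)) hy hne (d := N - 1) hdim'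
  · -- the chain of local near-point steps
    intro i
    have hgap : mH i + 1 + (mH (i + 1) - (mH i + 1)) = mH (i + 1) := by
      have hlt : mH i < mH (i + 1) := hmHmono (Nat.lt_succ_self i)
      omega
    obtain ⟨e⟩ := nonempty_stalkIso_of_misses_of_isBlowup hb hover (mH i + 1) (mH (i + 1) - (mH i + 1)) (hmiss i)
    have hS' : IsLocalSchemeAt (S (i + 1)) (pt (i + 1)) (c (mH i + 1)).W (η (mH i + 1)) := by
      have e' : (c (mH i + 1)).W.presheaf.stalk (η (mH i + 1)) ≅ (c (mH (i + 1))).W.presheaf.stalk (η (mH (i + 1))) :=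
        e ≪≫ eqToIso (by rw [hgap])
      exact isLocalSchemeAt_Spec_of_iso e'
    haveI : IsLocallyNoetherian (c (mH i)).W := (c (mH i)).ln
    haveI : IsLocallyNoetherian (c (mH i + 1)).W := (c (mH i + 1)).ln
    have hnear : Scheme.hsFun (c (mH i + 1)).W N (η (mH i + 1)) = Scheme.hsFun (c (mH i)).W N (η (mH i)) := by
      rw [Scheme.mem_hsStratum_iff.mp (hην (mH i + 1)), Scheme.mem_hsStratum_iff.mp (hην (mH i))]
    exact isLocalNearPointStep_of_isBlowup (hb (mH i)) (hrad i)
      (stalkIdeal_eq_maximalIdeal_of_isGenericPoint_of_isRegular _ (hcen (mH i) (hZC i)).1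
        (mem_componentsIn_of_subset (hZ (mH i)) (hcen (mH i) (hZC i)).2 (hZC i)) (hη (mH i)))
      N (hover (mH i)) hnear (huniq (mH i) (hmH i).1) hS'
  · -- isolation
    intro i
    exact (hinv (mH i)).isIsolatedInHSMaxLocus_closedPoint_of_isGenericPoint (hZ (mH i)) (hη (mH i))

/-- **A component of the stratum through a NEVER-ISOLATED closed marked point is positive-dimensional** (good stage; stub-4's
`singleton_notMem_componentsIn_of_not_iso` through `CycleInvPlus.cycleInv_forget`'s device). [cite: CossartJannsenSaito2020, Lemma 2.36, Def. 2.35] -/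
theorem nontrivial_of_mem_componentsThrough_of_not_iso {s : MarkedStage.{u}} (hgood : RunGood k N ν s.W)
    (hpt : s.pt ∈ Scheme.hsStratum s.W N ν) (hnot : ¬ Iso N s) {Z : Set s.W} (hZ : Z ∈ componentsThrough N ν s) :
    Z.Nontrivial := by
  have hinv : Moving.CycleInv k (fun _ _ => True) N ν ⟨s.W, s.ln, Labelling.init s.W, none, s.pt⟩ :=
    { overField := hgood.overField
      isReduced := hgood.isReduced
      dim_le := hgood.dim_le
      supMax := hgood.supMax
      label_le_year := fun _ => le_rfl
      pending := fun _ h => by cases h }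
  by_contra hZs
  rw [Set.not_nontrivial_iff] at hZs
  have hZe : Z = {s.pt} := hZs.eq_singleton_of_mem hZ.2
  exact hinv.singleton_notMem_componentsIn_of_not_iso hpt (fun hI => hnot hI) (hZe ▸ hZ.1)

end BlowupData

/-! ## §3. The transfer row along the chains of ANY functional boundary-reading strategy with permissible in-stratum centres -/

section SigmaE

variable {N : ℕ} {ν : ℕ → ℕ} {k : Type u} [Field k] {σ : StrategyE.{u}} {c : ℕ → MarkedStageE.{u}}

/-- **THE TRANSFER ROW (T) ALONG σE-CHAINS — PROVED, for EVERY functional `σ : StrategyE` whose steps at the chain's states have PERMISSIBLE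
centres INSIDE the stratum** (e.g. `σ` admissible on a scope containing the chain's states: Ω⁺E, res-L1-type-o1's menu-disciplined hybrids
`π.hybrid τ` on good scopes), the stages being GOOD (`RunGood` — along admissible runs from maximal origins by `runGood_of_stateReachesσE`):
a moving lineage along a never-isolated σE-chain (components `Z n ∋ x_n`, domination under a step projection `StepProjectionσE`, `Z m` inside an
allowed centre for infinitely many `m`) localises to an infinite local near-point chain on `S_0` excellent, reduced, of dimension `≤ N − 1`
with isolated closed points. Functionality is used only to identify a hit centre with the one the step projection presents.
[cite: CossartJannsenSaito2020, Lemma 6.30, Prop. 6.31, Def. 3.1 (2), p. 107] -/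
theorem movingLineageLocalizes_σE (hσ : σ.IsFunctional N ν) (hgood : ∀ n, RunGood k N ν (c n).W)
    (hadm : ∀ n (C : (c n).W.IdealSheafData) (P' : Option (Pending (blowup C))),
      σ.step (c n).W (c n).ln N ν (c n).L (c n).P (c n).E C P' →
        IdealSheafData.IsPermissible C ∧ (C.support : Set (c n).W) ⊆ Scheme.hsStratum (c n).W N ν)
    (hpt : ∀ n, (c n).pt ∈ Scheme.hsStratum (c n).W N ν)
    (hnot : ∀ n, ¬ Iso N (c n).toMarkedStage) {Z : ∀ n, Set (c n).W}
    (hZcomp : ∀ n, Z n ∈ componentsThrough N ν (c n).toMarkedStage)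
    (hZdom : ∀ n, ∃ g : (c (n + 1)).W ⟶ (c n).W, StepProjectionσE σ N ν (c n) (c (n + 1)) g ∧
      closure (g.base '' Z (n + 1)) = Z n)
    (hZhit : ∀ n, ∃ m, n ≤ m ∧ ∃ (D : (c m).W.IdealSheafData) (P' : Option (Pending (blowup D))),
      σ.step (c m).W (c m).ln N ν (c m).L (c m).P (c m).E D P' ∧ Z m ⊆ (D.support : Set (c m).W)) :
    ∃ (S : ℕ → Scheme.{u}) (ln : ∀ i, IsLocallyNoetherian (S i)) (pt : ∀ i, S i),
      Scheme.IsExcellent (S 0) ∧ IsReduced (S 0) ∧ topologicalKrullDim ↥(S 0) ≤ ((N - 1 : ℕ) : WithBot ℕ∞) ∧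
      IsLocalNearPointChain N S pt ∧ ∀ i, @IsIsolatedInHSMaxLocus (S i) (ln i) N (pt i) := by
  -- the lineage's step projections, the centres they present, and the blow-up data
  choose f hf hdom using hZdom
  have hfC : ∀ n, ∃ C : (c n).W.IdealSheafData,
      (∃ P' : Option (Pending (blowup C)), σ.step (c n).W (c n).ln N ν (c n).L (c n).P (c n).E C P') ∧ IsBlowup (f n) C := by
    intro n
    obtain ⟨C, P', hln, x', hcs, -, -, -, e, hfe⟩ := hf n
    refine ⟨C, ⟨P', hcs⟩, ?_⟩
    rw [hfe]
    exact (blowup.isBlowup C).iso_comp (eqToIso (congrArg MarkedStage.W (congrArg MarkedStageE.toMarkedStage e)))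
  choose C hC hb using hfC
  have hcen : ∀ n, Literature.AlgebraicGeometry.Resolution.Scheme.IsRegular (C n).subscheme ∧
      ((C n).support : Set (c n).W) ⊆ Scheme.hsStratum (c n).W N ν := fun n => by
    obtain ⟨P', hcs⟩ := hC n
    obtain ⟨h1, h2⟩ := hadm n (C n) P' hcs
    exact ⟨isRegular_subscheme_of_isPermissible h1, h2⟩
  -- hits, read on the presented centres (functional strategy: the allowed centre is unique)
  have hhit : ∀ n, ∃ m, n ≤ m ∧ Z m ⊆ ((C m).support : Set (c m).W) := fun n => by
    obtain ⟨m, hnm, D, P', hcs', hZD⟩ := hZhit n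
    obtain ⟨P, hcs⟩ := hC m
    have hDC : D = C m := (hσ (c m).W (c m).ln (c m).L (c m).P (c m).E).1 D (C m) P' P hcs' hcs
    subst hDC
    exact ⟨m, hnm, hZD⟩
  exact movingLineageLocalizes_of_blowupData (c := fun n => (c n).toMarkedStage) hgood hb (fun n => (hZcomp n).1)
    (fun n => nontrivial_of_mem_componentsThrough_of_not_iso (hgood n) (hpt n) (hnot n) (hZcomp n)) hdom
    (fun n _ => hcen n) hhit

/-- **NO MOVING LINEAGE along never-isolated σE-chains at levels `0 < N ≤ 3`, FROM THE KILL ROW** (same scope as `movingLineageLocalizes_σE`):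
the (c-geo) phenomenon for every functional boundary-reading strategy with permissible in-stratum centres on good stages — the local chain of §3
lives on `S_0` of dimension `≤ N − 1 ≤ 2` and `< N`, which `Moving.LocalNearPointChainsTerminate` forbids.
[cite: CossartJannsenSaito2020, Lemma 6.30, p. 98 Step 9, Cor. 6.37, Thm. 6.40, p. 107] -/
theorem no_movingLineage_σE_of_localChains (hK : LocalNearPointChainsTerminate.{u}) (hN0 : 0 < N) (hN3 : N ≤ 3)
    (hσ : σ.IsFunctional N ν) (hgood : ∀ n, RunGood k N ν (c n).W)
    (hadm : ∀ n (C : (c n).W.IdealSheafData) (P' : Option (Pending (blowup C))),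
      σ.step (c n).W (c n).ln N ν (c n).L (c n).P (c n).E C P' →
        IdealSheafData.IsPermissible C ∧ (C.support : Set (c n).W) ⊆ Scheme.hsStratum (c n).W N ν)
    (hpt : ∀ n, (c n).pt ∈ Scheme.hsStratum (c n).W N ν)
    (hnot : ∀ n, ¬ Iso N (c n).toMarkedStage) :
    ¬ ∃ Z : ∀ n, Set (c n).W, (∀ n, Z n ∈ componentsThrough N ν (c n).toMarkedStage) ∧
        (∀ n, ∃ g : (c (n + 1)).W ⟶ (c n).W, StepProjectionσE σ N ν (c n) (c (n + 1)) g ∧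
          closure (g.base '' Z (n + 1)) = Z n) ∧
        ∀ n, ∃ m, n ≤ m ∧ ∃ (D : (c m).W.IdealSheafData) (P' : Option (Pending (blowup D))),
          σ.step (c m).W (c m).ln N ν (c m).L (c m).P (c m).E D P' ∧ Z m ⊆ (D.support : Set (c m).W) := by
  rintro ⟨Z, hZcomp, hZdom, hZhit⟩
  obtain ⟨S, ln, pt, hexc, hred, hdim, hchain, hiso⟩ :=
    movingLineageLocalizes_σE hσ hgood hadm hpt hnot hZcomp hZdom hZhit
  have h1 : ((N - 1 : ℕ) : WithBot ℕ∞) ≤ (2 : WithBot ℕ∞) := by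
    have : N - 1 ≤ 2 := by omega
    exact_mod_cast this
  have h2 : ((N - 1 : ℕ) : WithBot ℕ∞) < (N : WithBot ℕ∞) := by
    have : N - 1 < N := by omega
    exact_mod_cast this
  exact hK N S ln pt hexc hred (hdim.trans h1) (lt_of_le_of_lt hdim h2) hchain hiso

/-- … CLOSED MODULO PRINT (`LocalChainPrintedFacts`, res-D-pv-046's `localNearPointChainsTerminate_of_printedFacts`).
[cite: CossartJannsenSaito2020, Lemma 6.30, p. 98 Step 9, Cor. 6.37, Thm. 6.40, Thm. 3.14, p. 107] -/
theorem no_movingLineage_σE_of_printedFacts (hF : LocalChainPrintedFacts.{u}) (hN0 : 0 < N) (hN3 : N ≤ 3)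
    (hσ : σ.IsFunctional N ν) (hgood : ∀ n, RunGood k N ν (c n).W)
    (hadm : ∀ n (C : (c n).W.IdealSheafData) (P' : Option (Pending (blowup C))),
      σ.step (c n).W (c n).ln N ν (c n).L (c n).P (c n).E C P' →
        IdealSheafData.IsPermissible C ∧ (C.support : Set (c n).W) ⊆ Scheme.hsStratum (c n).W N ν)
    (hpt : ∀ n, (c n).pt ∈ Scheme.hsStratum (c n).W N ν)
    (hnot : ∀ n, ¬ Iso N (c n).toMarkedStage) :
    ¬ ∃ Z : ∀ n, Set (c n).W, (∀ n, Z n ∈ componentsThrough N ν (c n).toMarkedStage) ∧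
        (∀ n, ∃ g : (c (n + 1)).W ⟶ (c n).W, StepProjectionσE σ N ν (c n) (c (n + 1)) g ∧
          closure (g.base '' Z (n + 1)) = Z n) ∧
        ∀ n, ∃ m, n ≤ m ∧ ∃ (D : (c m).W.IdealSheafData) (P' : Option (Pending (blowup D))),
          σ.step (c m).W (c m).ln N ν (c m).L (c m).P (c m).E D P' ∧ Z m ⊆ (D.support : Set (c m).W) :=
  no_movingLineage_σE_of_localChains (localNearPointChainsTerminate_of_printedFacts hF) hN0 hN3 hσ hgood hadm hpt hnot

end SigmaE

/-! ## §4. The Ω⁺E instance from a maximal origin -/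

section OmegaE

variable {ω : StageOracleE.{u}} {N : ℕ} {ν : ℕ → ℕ}

/-- **The Ω⁺E strategy of a functional boundary-reading stage oracle is functional** (the lemma announced in the module docstring of
`…Corridor3SigmaCyclePlusBoundaryDefs`, p525032, from its `IsCanonicalStepΩplusE.centre_unique` / `.pending_unique`). [folklore] -/
theorem StrategyE.isFunctional_ofStageOraclePlusE (hω : OracleFunctionalΩE ω) (N : ℕ) (ν : ℕ → ℕ) :
    (StrategyE.ofStageOraclePlusE ω).IsFunctional N ν :=
  fun _ _ _ _ _ =>
    ⟨fun _ _ _ _ h₁ h₂ => IsCanonicalStepΩplusE.centre_unique hω h₁ h₂,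
      fun _ _ _ h₁ h₂ => IsCanonicalStepΩplusE.pending_unique hω h₁ h₂⟩

/-- **THE TRANSFER ROW (T) ALONG Ω⁺E-CHAINS FROM A MAXIMAL ORIGIN — PROVED** (functional Ω⁺E-admissible boundary-reading stage oracle,
`ν ≠ Φ^{(N)}`, any initial boundary `E₀`): good stages and the centre clauses by res-D-brk-3's `exists_cycleInvPlus_chainE` /
`CycleInvPlus.centreE`, functionality by `StrategyE.isFunctional_ofStageOraclePlusE` (above). [cite: CossartJannsenSaito2020, Lemma 6.30, Prop. 6.31, p. 107] -/
theorem movingLineageLocalizes_ΩplusE (hωf : OracleFunctionalΩE ω) (hω : OracleAdmissibleΩplusE ω) (hν : ν ≠ iterPSum N Phi)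
    {p : ℕ} {X : Scheme.{u}} [IsLocallyNoetherian X] {x : X} (hX : IsMaximalOrigin p N ν X x) {E₀ : Boundary X}
    {c : ℕ → MarkedStageE.{u}} (h0 : ReachesσE (StrategyE.ofStageOraclePlusE ω) N ν (MarkedStageE.init X x E₀) (c 0))
    (hstep : ∀ n, CanonicalNearStepσE (StrategyE.ofStageOraclePlusE ω) N ν (c n) (c (n + 1)))
    (hnot : ∀ n, ¬ Iso N (c n).toMarkedStage) {Z : ∀ n, Set (c n).W}
    (hZcomp : ∀ n, Z n ∈ componentsThrough N ν (c n).toMarkedStage)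
    (hZdom : ∀ n, ∃ g : (c (n + 1)).W ⟶ (c n).W, StepProjectionσE (StrategyE.ofStageOraclePlusE ω) N ν (c n) (c (n + 1)) g ∧
      closure (g.base '' Z (n + 1)) = Z n)
    (hZhit : ∀ n, ∃ m, n ≤ m ∧ ∃ (D : (c m).W.IdealSheafData) (P' : Option (Pending (blowup D))),
      (StrategyE.ofStageOraclePlusE ω).step (c m).W (c m).ln N ν (c m).L (c m).P (c m).E D P' ∧
        Z m ⊆ (D.support : Set (c m).W)) :
    ∃ (S : ℕ → Scheme.{u}) (ln : ∀ i, IsLocallyNoetherian (S i)) (pt : ∀ i, S i),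
      Scheme.IsExcellent (S 0) ∧ IsReduced (S 0) ∧ topologicalKrullDim ↥(S 0) ≤ ((N - 1 : ℕ) : WithBot ℕ∞) ∧
      IsLocalNearPointChain N S pt ∧ ∀ i, @IsIsolatedInHSMaxLocus (S i) (ln i) N (pt i) := by
  obtain ⟨k, _, hinv⟩ := exists_cycleInvPlus_chainE hω hν hX E₀ h0 hstep
  have hgood : ∀ n, RunGood k N ν (c n).W := fun n =>
    ⟨(hinv n).overField, (hinv n).isReduced, (hinv n).dim_le, (hinv n).supMax⟩
  have hadm : ∀ n (C : (c n).W.IdealSheafData) (P' : Option (Pending (blowup C))),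
      (StrategyE.ofStageOraclePlusE ω).step (c n).W (c n).ln N ν (c n).L (c n).P (c n).E C P' →
        IdealSheafData.IsPermissible C ∧ (C.support : Set (c n).W) ⊆ Scheme.hsStratum (c n).W N ν := by
    intro n C P' hcs
    obtain ⟨-, h2, h3, -⟩ := (hinv n).centreE hω hν hcs
    exact ⟨h3, h2⟩
  have hpt : ∀ n, (c n).pt ∈ Scheme.hsStratum (c n).W N ν := fun n =>
    pt_mem_hsStratum_of_reachesσE (reachesσE_chain h0 hstep n) hX.mem_stratum
  exact movingLineageLocalizes_σE (StrategyE.isFunctional_ofStageOraclePlusE hωf N ν) hgood hadm hpt hnot hZcomp hZdom hZhit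

end OmegaE

end Summit.ResolutionOfSingularities.ResolutionOfSingularities.Theorems.SigmaMaxModificationsCorridor3.Sigma

end
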